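/-
Copyright: fleet lead `ym-wcr-19609-p1` (seat prover-ym-wcr-19609-p1-g0-0), route `WeakCouplingRates`, crux
`BulkDominatesColdBoxW` (stmt-QuantumFields-19609), line `dlr-chessboard` (skeleton v4, sha16 355a68b80645dd42).
-/
import Summits.QuantumFields.YangMills.Theorems.WeakCouplingRatesBulkDominatesColdBoxWStubLargeFieldRarity
import Summits.QuantumFields.YangMills.Theorems.WeakCouplingRatesBulkDominatesColdBoxWStubDlrAssembly
import Summits.QuantumFields.YangMills.Theorems.WeakCouplingRatesBulkDominatesColdBoxWBoxPolyFloorOfBox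
import Summits.QuantumFields.YangMills.Theorems.WeakCouplingRatesCurvatureCorrPowerFloor

/-!
# Crux `BulkDominatesColdBoxW` (stmt-QuantumFields-19609) REDUCED to its two analytic stubs and the BOX crux — kernel-checked milestone

After today's landings on the line `dlr-chessboard` (L2 `stub_largeFieldRarity` p445862, L3 `stub_dlrAssembly` p448414,
`boxPolyFloor_of_box_floor` p448845, FLOOR item 19457 `curvatureCorrPowerFloor_proof` p451030), the rank-2 crux BULK_W of route
`WeakCouplingRates` is EXACTLY the conjunction of
* L1a `GoodBoundaryCovStable` along the family `(A, δ) = (θ/20, θ/5)` under a ceiling (the registered stub `stub_goodBoundaryCovStable`),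
* L1b `GoodBoundaryMeanSmooth` likewise (`stub_goodBoundaryMeanSmooth`),
* the route's OTHER crux BOX_W `ColdBoxTwoPointFloorW` (stmt-QuantumFields-19608),
as the theorem `bulkDominatesColdBoxW_of_goodBoundary` below records (the composition `BulkDominatesColdBoxW_of` of the registered
skeleton v4 with `stub_boxPolyFloor := boxPolyFloor_of_box_floor BOX_W FLOOR`).  Since the route's deciding theorem `closes` consumes
BOX_W anyway, the net open content of crux 19609 is L1a ∧ L1b: «the first two (connected) moments of the Wilson box kernel at depth
`⌈β^θ⌉` are stable UNIFORMLY over crude-good boundary data» — the boundary-influence-decay statement on which the catalogued barrier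
`UVStabilityNonUniqueness` bites (see the lead's FINDING-19609-census.md, item evidence #6).  A CONDITIONAL result (hypotheses are the
two open stubs and BOX_W, stated verbatim); it closes nothing by itself.  NOT a claim about the mass gap.
-/

set_option autoImplicit false

open Summit.QuantumFields.YangMills.Theses.WeakCouplingRates (ColdBoxTwoPointFloorW BulkDominatesColdBoxW)

namespace Summit.QuantumFields.YangMills.Theorems.WeakCouplingRates

/-- **BULK_W ⇐ L1a ∧ L1b ∧ BOX_W** (kernel-checked reduction of crux `stmt-QuantumFields-19609`): given the two open analytic stubs of
the DLR–chessboard line — deep box-kernel covariances stable (`GoodBoundaryCovStable (θ/20) θ (θ/5) η₁`) and deep conditional means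
position-smooth (`GoodBoundaryMeanSmooth (θ/20) θ (θ/5)`) for all small `θ`, uniformly over crude-good boundary data — and the BOX crux
`ColdBoxTwoPointFloorW`, the torus states dominate the cold box: `BulkDominatesColdBoxW`.  Proof: θ := min of the four ceilings;
L2 (`stub_largeFieldRarity`), L3 (`stub_dlrAssembly`) and FLOOR (`curvatureCorrPowerFloor_proof`) are tree theorems;
`stub_boxPolyFloor := boxPolyFloor_of_box_floor`. [folklore] -/
theorem bulkDominatesColdBoxW_of_goodBoundary
    (h1a : ∃ θ₁ : ℝ, 0 < θ₁ ∧ ∀ θ : ℝ, 0 < θ → θ ≤ θ₁ → ∃ η₁ : ℝ, 0 < η₁ ∧ GoodBoundaryCovStable (θ / 20) θ (θ / 5) η₁)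
    (h1b : ∃ θ₁ : ℝ, 0 < θ₁ ∧ ∀ θ : ℝ, 0 < θ → θ ≤ θ₁ → GoodBoundaryMeanSmooth (θ / 20) θ (θ / 5))
    (hBox : ColdBoxTwoPointFloorW) : BulkDominatesColdBoxW := by
  obtain ⟨θa, hθa, ha⟩ := h1a
  obtain ⟨θb, hθb, hb⟩ := h1b
  obtain ⟨θk, hθk, hk⟩ := boxPolyFloor_of_box_floor hBox curvatureCorrPowerFloor_proof
  intro θ₀ hθ₀
  have hθpos : 0 < min θ₀ (min θa (min θb θk)) := lt_min hθ₀ (lt_min hθa (lt_min hθb hθk))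
  have hθ0 : min θ₀ (min θa (min θb θk)) ≤ θ₀ := min_le_left _ _
  have hθa' : min θ₀ (min θa (min θb θk)) ≤ θa := le_trans (min_le_right _ _) (min_le_left _ _)
  have hθb' : min θ₀ (min θa (min θb θk)) ≤ θb :=
    le_trans (min_le_right _ _) (le_trans (min_le_right _ _) (min_le_left _ _))
  have hθk' : min θ₀ (min θa (min θb θk)) ≤ θk :=
    le_trans (min_le_right _ _) (le_trans (min_le_right _ _) (min_le_right _ _))
  obtain ⟨η₁, hη, h1a'⟩ := ha _ hθpos hθa'
  refine ⟨min θ₀ (min θa (min θb θk)) / 20, min θ₀ (min θa (min θb θk)), by positivity, by linarith, hθ0, ?_⟩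
  exact stub_dlrAssembly _ _ _ η₁ _ (by positivity) (by positivity) hη (by linarith) h1a' (hb _ hθpos hθb')
    (stub_largeFieldRarity _ (by positivity)) (hk _ hθpos hθk')

/-- **The rung leaf through the rates route, reduced**: `XiPowSU2 ⇐ L1a ∧ L1b ∧ BOX_W`.  With FLOOR proved
(`curvatureCorrPowerFloor_proof`) and BULK_W reduced (`bulkDominatesColdBoxW_of_goodBoundary`), the route's deciding theorem
`Theses.WeakCouplingRates.closes` turns the two open analytic stubs of crux 19609 and the BOX crux 19608 into the registered rung leaf
`XiPowSU2` (SU(2)₄: every RP gap of every torus-limit state is `≤ β^{−ε}` for large `β`).  CONDITIONAL (three hypotheses, stated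
verbatim); closes nothing by itself. [folklore] -/
theorem xiPowSU2_of_goodBoundary_box
    (h1a : ∃ θ₁ : ℝ, 0 < θ₁ ∧ ∀ θ : ℝ, 0 < θ → θ ≤ θ₁ → ∃ η₁ : ℝ, 0 < η₁ ∧ GoodBoundaryCovStable (θ / 20) θ (θ / 5) η₁)
    (h1b : ∃ θ₁ : ℝ, 0 < θ₁ ∧ ∀ θ : ℝ, 0 < θ → θ ≤ θ₁ → GoodBoundaryMeanSmooth (θ / 20) θ (θ / 5))
    (hBox : ColdBoxTwoPointFloorW) : XiPowSU2 :=
  Summit.QuantumFields.YangMills.Theses.WeakCouplingRates.closes (bulkDominatesColdBoxW_of_goodBoundary h1a h1b hBox) hBox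
    curvatureCorrPowerFloor_proof

end Summit.QuantumFields.YangMills.Theorems.WeakCouplingRates
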